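import Summits.QuantumFields.YangMills.Theorems.BalabanUVNodesN21ShellSplitOfRecord13CoPHDefs
import Literature.Probability.MarkovChains.HellingerAffinity

/-!
# N21 (NE7c) · THE SHELL SPLIT OF RECORD, TERM LEVEL: the (R)-fields `0 ≤ σ ≤ weight`, the per-cube COVER, per-top-cube (M1) ⇒ the run's total shell part, the CORE
# of record = the term re-tested at the lowered threshold, and the COUNT of top cubes — all PROVED at NODE 00's objects of record (generality `ϑ D g₀ os p g k`)

R134 seat `pub-ymgap-dag-n21-d` (g9), node N21 = NE7c (single-run shell-weight bound; NOT PRINTED in [Bałaban 1983–89], NOT proved), strategy s2 = the by-name knit AT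
THE RECORD (row «`ShellWeightBound` :403 at explicit carriers → the record»); lane K3⁷ `SpineGivenEndpointR13SepCoPH` (stmt-QuantumFields-20544, `--supports … --as
helper`; COUNT-NEUTRAL).  Imports the definition-lane companion `…N21ShellSplitOfRecord13CoPHDefs` (hence n20-d's `…SpineReadingOfRecord13CoPH` p587226 and def-T's
`Node00/StepWeightsAtThresholds`) and `Literature.Probability.MarkovChains.HellingerAffinity` (Weierstrass's product inequality `1 − Π q ≤ Σ (1 − q)`, CITED BY NAME:
`one_sub_prod_le_sum_one_sub`, [LevinPeres2017] (20.29)).  Keyed sequel (the face AT `crOfRecord₁₃At`): `…N21ShellSplitOfRecord13CoPHKeyed`.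
[III] = [Balaban1988Convergent], [LF-I] = [Balaban1989LargeFieldI].

WHAT THIS FILE PROVES (theorems only; 0 `def`, 0 `sorry`).
* §1 measurability of ONE top cube's (2.17) indicator of record under (H-U) (`measurable_cubeChiAt`); its range `[0,1]`.
* §2 POINTWISE, per field `V`: the shell integrand `χ_k^{ε}(s)(1 − χ_k^{ε(1−ρ)}(s))·slot_s` and the cube pieces `(1 − χ_a^{ε(1−ρ)})·χ_k^{ε}(s)·slot_s` lie in
  `[0, χ_k^{ε}(s)·slot_s]`, and the COVER `shell ≤ Σ_{a ⊂ Ω_k(s)} piece_a` (Weierstrass at def-T's product face `χ_k^{δ}(s) = Π_{a⊂Ω_k(s)} χ_a^{δ}`).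
* §3 TERM LEVEL (displayed: (H-U) `LocalBgMeasurable`, `0 ≤ w` (born of `0 ≤ ζ`), F3's (e1) integrability `hint` of `χ_k(s)·slot_s`):
  `shellWeightOfDatum₉_nonneg` · `shellWeightOfDatum₉_le_classWeight` (n20-w1's socket rows `hσa0 ∕ hσa`) · `shellPieceOfDatum₉_nonneg` · `cubeWeightOfDatum₉_le_classWeight` ·
  `cubeWeightOfDatum₉_nonneg` ·
  ★ `shellWeightOfDatum₉_le_sum_pieces` (THE COVER) · ★★ `sum_shellWeight_le_of_cubeAC` (per-top-cube (M1) with constant `c` ⇒ the run's TOTAL shell part is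
  `≤ (#top cubes · c) ×` its dressed partition sum — `T4ShellMeasure.shell_sum_le_of_slots` BY NAME).
* §3b THE CORE OF RECORD: `classWeight_sub_shellWeight_eq` · ★★ `classWeight_sub_shellWeight_eq_lowered` — for `0 ≤ ε_k ρ`, `A − shA` per term IS
  `∫ χ_k^{ε_k(1−ρ)}(Ω_k(s))·slot_s`, the (2.18) class weight with the (2.17) test at the LOWERED threshold (N19′'s core made a definite object of record).
* §4 THE COUNT: `card_cubeIndices_top_le` — at the top level `k = Kc` the `L^{k+1}M₂R_k`-partition of the cutoff-`Kc` torus (side `2L^{m+Kc}`) has `≤ (2L^m)⁴` cubes,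
  UNIFORMLY IN `Kc` (the END's `LiveWindow` letters, COUNTED: window depth `N₁ = 0`, `ν̄ = (2L^m)⁴`).

THE ONE DISPLAYED ESTIMATE (consumed by `sum_shellWeight_le_of_cubeAC`, per run, per `(t, top cube a)`): (M1) ON THE RECORD's `a`-TRUNCATED DRESSED LAW,
  `Σ_s shellPieceOfDatum₉ … ρ t a s ≤ c · Σ_s cubeWeightOfDatum₉ … t a s`,
i.e. under the positive measure `Σ_{s : a ⊂ Ω_k(s)} χ_k^{ε_k}(s)·slot^t_s dV_k` (the dressed law restricted to the terms testing `a`, `a`'s own `ε_k`-cut included) the event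
«cube `a` FAILS the (2.17) test at the lowered threshold `ε_k(1 − ρ)`» has relative mass `≤ c` — `T4ShellMeasure.SlotAntiConcentration` on the CUT law, asked of a DEFINITE
object.  NOT PRINTED; NOT proved here; the hazard ∕ dilation roads (this seat's parts 7–39) are its [textbook] reductions.

HONEST FRAMING.  [folklore] measure ∕ finite-sum bookkeeping over NODE 00's objects of record; NO estimate of Bałaban's asserted or used; widths `ρ` and constants are
LETTERS (A6: `ρ = 0` is the junk width — zero shell part, (M1) with `0`; content only at N16's closeness widths, jointly with N19′'s core, which §3b names); no
`Provisos` inhabitant claimed (K0⁷ open); NE7c NOT PRINTED ∕ NOT proved; N21 NOT discharged; K3⁷ NOT claimed; counts UNMOVED (typed 28∕28 · discharged 5∕27); never a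
count claim.  No `instance`, no `notation`, no `def`.  One finite four-torus programme at fixed `ε` — NOT ℝ⁴, NOT OS, NOT a mass gap, NOT the Clay problem.
-/

noncomputable section

open scoped BigOperators
open Finset MeasureTheory

namespace Summit.QuantumFields.YangMills.Theorems.N21ShellSplitOfRecord13CoPH

open Literature.MathematicalPhysics.QuantumFieldTheory.Balaban1983to89
open Literature.MathematicalPhysics.QuantumFieldTheory.Balaban1983to89.T4Continuum
open Literature.MathematicalPhysics.QuantumFieldTheory.Balaban1983to89.Node00
open Summit.QuantumFields.YangMills.BalabanUVNodes.N19MGFRoadLiveSelectorTower (dressedSlotsOfDatum₉_nonneg)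
open Literature.Probability.MarkovChains (one_sub_prod_le_sum_one_sub)


/-! ## §1 One cube's indicator is measurable under (H-U) and lies in `[0,1]` (Weierstrass's product inequality is cited by name) -/

section CubeFacts

variable (F : T4Family) (N : ℕ) [NeZero N] (ν : Stage7Numerics) (g : ℕ → ℝ) (Kc k : ℕ)

/-- measurability of the small-field event on a plaquette set (restated [folklore]; cf. `T4AxialGaugeFixing.measurableSet_plaqSmallOn`, not imported). -/
private theorem measurableSet_plaqSmallOn'' {P : Params} {j : ℕ} (S : Set (Plaq P j)) (δ : ℝ) :
    MeasurableSet {U : GaugeField P j (SU N) | PlaqSmallOn S δ U} := by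
  have h : {U : GaugeField P j (SU N) | PlaqSmallOn S δ U} = ⋂ p : {p : Plaq P j // p ∈ S}, {U | dist1 (GaugeField.plaqHol U p.1) < δ} := by
    ext U; simp only [PlaqSmallOn, Set.mem_setOf_eq, Set.mem_iInter, Subtype.forall]
  rw [h]
  exact MeasurableSet.iInter fun p =>
    measurableSet_lt (RegularGaugeGroup.measurable_dist1.comp (Missing.measurable_plaqHol p.1)) measurable_const

/-- **ONE CUBE's INDICATOR IS MEASURABLE UNDER (H-U)** (the (2.12) solution map of record is measurable, K0′'s displayed row). [bookkeeping] -/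
theorem measurable_cubeChiAt (hU : LocalBgMeasurable F N ν) (δ : ℝ)
    (a : ↥(cubeIndices (F.P Kc) (cubeSide (F.P Kc).L ν.M₂ (RkOfRecord (F.P Kc).L ν.r (g k)) k))) :
    Measurable (cubeChiAt F N ν g Kc k δ a) := by
  unfold cubeChiAt chiSmall
  refine Measurable.ite ?_ measurable_const measurable_const
  exact (measurableSet_plaqSmallOn'' N _ _).preimage (hU Kc k _)

/-- `0 ≤ χ_a`. [bookkeeping] -/
theorem cubeChiAt_nonneg (δ : ℝ) (a : ↥(cubeIndices (F.P Kc) (cubeSide (F.P Kc).L ν.M₂ (RkOfRecord (F.P Kc).L ν.r (g k)) k)))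
    (V : GaugeField (F.P Kc) k (SU N)) : 0 ≤ cubeChiAt F N ν g Kc k δ a V := by
  rcases cubeChiAt_eq_zero_or_one F N ν g Kc k δ a V with h | h <;> norm_num [h]

/-- `χ_a ≤ 1`. [bookkeeping] -/
theorem cubeChiAt_le_one (δ : ℝ) (a : ↥(cubeIndices (F.P Kc) (cubeSide (F.P Kc).L ν.M₂ (RkOfRecord (F.P Kc).L ν.r (g k)) k)))
    (V : GaugeField (F.P Kc) k (SU N)) : cubeChiAt F N ν g Kc k δ a V ≤ 1 := by
  rcases cubeChiAt_eq_zero_or_one F N ν g Kc k δ a V with h | h <;> norm_num [h]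

end CubeFacts

/-! ## §2 Pointwise: the shell integrand and the cube pieces lie in `[0, χ_k(s)·slot_s]`; the cover -/

section Pointwise

variable (F : T4Family) (N : ℕ) [NeZero N] (ϑ : Stage9Params F N) (D : FiniteEpsData F (SU N)) (g₀ : ℕ → ℝ) (os : List (ULoop F))
  (p : B12.RunParams) (g : ℕ → ℝ) (k : ℕ)

/-- **THE SHELL INTEGRAND IS NONNEGATIVE** (`χ ≥ 0`, `χ′ ≤ 1`, `slot ≥ 0` from `0 ≤ w`). [bookkeeping] -/
theorem shellIntegrand_nonneg (hw0 : ∀ k s' U V', 0 ≤ wOfRecord₉ F N ϑ p g k s' U V') (δ t : ℝ) (s : SeqOfRecord F ϑ.ν ϑ.τ9.M g p.K k)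
    (V : GaugeField (F.P p.K) k (SU N)) :
    0 ≤ chiSeqOfRecord F N ϑ.ν ϑ.τ9.M g p.K k s V * (1 - chiSeqOfRecordAt F N ϑ.ν ϑ.τ9.M g p.K k δ s V) *
      dressedSlotsOfDatum₉ F N ϑ D g₀ os t p g k s V :=
  mul_nonneg (mul_nonneg (chiSeqOfRecord_nonneg F N ϑ.ν ϑ.τ9.M g p.K k s V) (sub_nonneg.2 (chiSeqOfRecordAt_le_one F N ϑ.ν ϑ.τ9.M g p.K k δ s V)))
    (dressedSlotsOfDatum₉_nonneg F N ϑ D g₀ os p g hw0 t k s V)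

/-- **THE SHELL INTEGRAND NEVER EXCEEDS THE CLASS-WEIGHT INTEGRAND** (`0 ≤ χ′`). [bookkeeping] -/
theorem shellIntegrand_le (hw0 : ∀ k s' U V', 0 ≤ wOfRecord₉ F N ϑ p g k s' U V') (δ t : ℝ) (s : SeqOfRecord F ϑ.ν ϑ.τ9.M g p.K k)
    (V : GaugeField (F.P p.K) k (SU N)) :
    chiSeqOfRecord F N ϑ.ν ϑ.τ9.M g p.K k s V * (1 - chiSeqOfRecordAt F N ϑ.ν ϑ.τ9.M g p.K k δ s V) *
        dressedSlotsOfDatum₉ F N ϑ D g₀ os t p g k s V ≤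
      chiSeqOfRecord F N ϑ.ν ϑ.τ9.M g p.K k s V * dressedSlotsOfDatum₉ F N ϑ D g₀ os t p g k s V := by
  have hχ := chiSeqOfRecord_nonneg F N ϑ.ν ϑ.τ9.M g p.K k s V
  have hχ' := chiSeqOfRecordAt_nonneg F N ϑ.ν ϑ.τ9.M g p.K k δ s V
  have hsl := dressedSlotsOfDatum₉_nonneg F N ϑ D g₀ os p g hw0 t k s V
  have h1 : chiSeqOfRecord F N ϑ.ν ϑ.τ9.M g p.K k s V * (1 - chiSeqOfRecordAt F N ϑ.ν ϑ.τ9.M g p.K k δ s V) ≤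
      chiSeqOfRecord F N ϑ.ν ϑ.τ9.M g p.K k s V := by nlinarith
  exact mul_le_mul_of_nonneg_right h1 hsl

/-- **A CUBE PIECE's INTEGRAND IS NONNEGATIVE.** [bookkeeping] -/
theorem pieceIntegrand_nonneg (hw0 : ∀ k s' U V', 0 ≤ wOfRecord₉ F N ϑ p g k s' U V') (δ t : ℝ)
    (a : ↥(cubeIndices (F.P p.K) (cubeSide (F.P p.K).L ϑ.ν.M₂ (RkOfRecord (F.P p.K).L ϑ.ν.r (g k)) k))) (s : SeqOfRecord F ϑ.ν ϑ.τ9.M g p.K k)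
    (V : GaugeField (F.P p.K) k (SU N)) :
    0 ≤ (1 - cubeChiAt F N ϑ.ν g p.K k δ a V) *
      (chiSeqOfRecord F N ϑ.ν ϑ.τ9.M g p.K k s V * dressedSlotsOfDatum₉ F N ϑ D g₀ os t p g k s V) :=
  mul_nonneg (sub_nonneg.2 (cubeChiAt_le_one F N ϑ.ν g p.K k δ a V))
    (mul_nonneg (chiSeqOfRecord_nonneg F N ϑ.ν ϑ.τ9.M g p.K k s V) (dressedSlotsOfDatum₉_nonneg F N ϑ D g₀ os p g hw0 t k s V))

/-- **A CUBE PIECE's INTEGRAND NEVER EXCEEDS THE CLASS-WEIGHT INTEGRAND.** [bookkeeping] -/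
theorem pieceIntegrand_le (hw0 : ∀ k s' U V', 0 ≤ wOfRecord₉ F N ϑ p g k s' U V') (δ t : ℝ)
    (a : ↥(cubeIndices (F.P p.K) (cubeSide (F.P p.K).L ϑ.ν.M₂ (RkOfRecord (F.P p.K).L ϑ.ν.r (g k)) k))) (s : SeqOfRecord F ϑ.ν ϑ.τ9.M g p.K k)
    (V : GaugeField (F.P p.K) k (SU N)) :
    (1 - cubeChiAt F N ϑ.ν g p.K k δ a V) *
        (chiSeqOfRecord F N ϑ.ν ϑ.τ9.M g p.K k s V * dressedSlotsOfDatum₉ F N ϑ D g₀ os t p g k s V) ≤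
      chiSeqOfRecord F N ϑ.ν ϑ.τ9.M g p.K k s V * dressedSlotsOfDatum₉ F N ϑ D g₀ os t p g k s V := by
  have h0 := cubeChiAt_nonneg F N ϑ.ν g p.K k δ a V
  have hI : 0 ≤ chiSeqOfRecord F N ϑ.ν ϑ.τ9.M g p.K k s V * dressedSlotsOfDatum₉ F N ϑ D g₀ os t p g k s V :=
    mul_nonneg (chiSeqOfRecord_nonneg F N ϑ.ν ϑ.τ9.M g p.K k s V) (dressedSlotsOfDatum₉_nonneg F N ϑ D g₀ os p g hw0 t k s V)
  nlinarith

/-- ★ **THE COVER, POINTWISE**: `χ_k^{ε}(s)(1 − χ_k^{δ}(s))·slot_s ≤ Σ_{a ⊂ Ω_k(s)} (1 − χ_a^{δ})·χ_k^{ε}(s)·slot_s` — Weierstrass (§1) at def-T's product face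
`χ_k^{δ}(s) = Π_{a⊂Ω_k(s)} χ_a^{δ}`: if SOME top cube of `s` fails the lowered test, one of the pieces is the whole integrand. [bookkeeping] -/
theorem shellIntegrand_le_sum_pieceIntegrand (hw0 : ∀ k s' U V', 0 ≤ wOfRecord₉ F N ϑ p g k s' U V') (δ t : ℝ)
    (s : SeqOfRecord F ϑ.ν ϑ.τ9.M g p.K k) (V : GaugeField (F.P p.K) k (SU N)) :
    chiSeqOfRecord F N ϑ.ν ϑ.τ9.M g p.K k s V * (1 - chiSeqOfRecordAt F N ϑ.ν ϑ.τ9.M g p.K k δ s V) *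
        dressedSlotsOfDatum₉ F N ϑ D g₀ os t p g k s V ≤
      ∑ a ∈ cubesOfSeq F ϑ.ν ϑ.τ9.M g p.K k s,
        (1 - cubeChiAt F N ϑ.ν g p.K k δ a V) *
          (chiSeqOfRecord F N ϑ.ν ϑ.τ9.M g p.K k s V * dressedSlotsOfDatum₉ F N ϑ D g₀ os t p g k s V) := by
  rw [← Finset.sum_mul, chiSeqOfRecordAt_eq_prod_cubeChiAt]
  have hI : 0 ≤ chiSeqOfRecord F N ϑ.ν ϑ.τ9.M g p.K k s V * dressedSlotsOfDatum₉ F N ϑ D g₀ os t p g k s V :=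
    mul_nonneg (chiSeqOfRecord_nonneg F N ϑ.ν ϑ.τ9.M g p.K k s V) (dressedSlotsOfDatum₉_nonneg F N ϑ D g₀ os p g hw0 t k s V)
  have hW := one_sub_prod_le_sum_one_sub (cubesOfSeq F ϑ.ν ϑ.τ9.M g p.K k s) (a := fun a => cubeChiAt F N ϑ.ν g p.K k δ a V)
    (fun a _ => cubeChiAt_nonneg F N ϑ.ν g p.K k δ a V) (fun a _ => cubeChiAt_le_one F N ϑ.ν g p.K k δ a V)
  calc chiSeqOfRecord F N ϑ.ν ϑ.τ9.M g p.K k s V * (1 - ∏ a ∈ cubesOfSeq F ϑ.ν ϑ.τ9.M g p.K k s, cubeChiAt F N ϑ.ν g p.K k δ a V) *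
        dressedSlotsOfDatum₉ F N ϑ D g₀ os t p g k s V
      = (1 - ∏ a ∈ cubesOfSeq F ϑ.ν ϑ.τ9.M g p.K k s, cubeChiAt F N ϑ.ν g p.K k δ a V) *
        (chiSeqOfRecord F N ϑ.ν ϑ.τ9.M g p.K k s V * dressedSlotsOfDatum₉ F N ϑ D g₀ os t p g k s V) := by ring
    _ ≤ (∑ a ∈ cubesOfSeq F ϑ.ν ϑ.τ9.M g p.K k s, (1 - cubeChiAt F N ϑ.ν g p.K k δ a V)) *
        (chiSeqOfRecord F N ϑ.ν ϑ.τ9.M g p.K k s V * dressedSlotsOfDatum₉ F N ϑ D g₀ os t p g k s V) :=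
        mul_le_mul_of_nonneg_right hW hI

end Pointwise

/-! ## §3 Term level: the (R)-fields, the cover, and per-top-cube (M1) ⇒ the run's total shell part -/

section Term

variable (F : T4Family) (N : ℕ) [NeZero N] (ϑ : Stage9Params F N) (D : FiniteEpsData F (SU N)) (g₀ : ℕ → ℝ) (os : List (ULoop F))
  (p : B12.RunParams) (g : ℕ → ℝ) (k : ℕ)

/-- ★ **THE TERM's SHELL PART IS NONNEGATIVE** (n20-w1's `hσa0 ∕ hσb0`). [bookkeeping] -/
theorem shellWeightOfDatum₉_nonneg (hw0 : ∀ k s' U V', 0 ≤ wOfRecord₉ F N ϑ p g k s' U V') (ρ t : ℝ) (s : SeqOfRecord F ϑ.ν ϑ.τ9.M g p.K k) :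
    0 ≤ shellWeightOfDatum₉ F N ϑ D g₀ os p g k ρ t s :=
  integral_nonneg fun V => shellIntegrand_nonneg F N ϑ D g₀ os p g k hw0 _ t s V

/-- ★ **THE TERM's SHELL PART NEVER EXCEEDS ITS CLASS WEIGHT** (n20-w1's `hσa ∕ hσb`; displayed: F3's (e1) integrability of `χ_k(s)·slot_s`). [bookkeeping] -/
theorem shellWeightOfDatum₉_le_classWeight (hw0 : ∀ k s' U V', 0 ≤ wOfRecord₉ F N ϑ p g k s' U V') (ρ t : ℝ) (s : SeqOfRecord F ϑ.ν ϑ.τ9.M g p.K k)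
    (hint : Integrable (fun V => chiSeqOfRecord F N ϑ.ν ϑ.τ9.M g p.K k s V * dressedSlotsOfDatum₉ F N ϑ D g₀ os t p g k s V)
      (fieldMeasure (F.P p.K) k (SU N))) :
    shellWeightOfDatum₉ F N ϑ D g₀ os p g k ρ t s ≤ classWeightOfDatum₉ F N ϑ D g₀ os p g k t s :=
  integral_mono_of_nonneg (ae_of_all _ fun V => shellIntegrand_nonneg F N ϑ D g₀ os p g k hw0 _ t s V) hint
    (ae_of_all _ fun V => shellIntegrand_le F N ϑ D g₀ os p g k hw0 _ t s V)

/-- **THE CLASS WEIGHT IS NONNEGATIVE.** [bookkeeping] -/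
theorem classWeightOfDatum₉_nonneg' (hw0 : ∀ k s' U V', 0 ≤ wOfRecord₉ F N ϑ p g k s' U V') (t : ℝ) (s : SeqOfRecord F ϑ.ν ϑ.τ9.M g p.K k) :
    0 ≤ classWeightOfDatum₉ F N ϑ D g₀ os p g k t s :=
  integral_nonneg fun V => mul_nonneg (chiSeqOfRecord_nonneg F N ϑ.ν ϑ.τ9.M g p.K k s V) (dressedSlotsOfDatum₉_nonneg F N ϑ D g₀ os p g hw0 t k s V)

/-- **A CUBE PIECE IS NONNEGATIVE.** [bookkeeping] -/
theorem shellPieceOfDatum₉_nonneg (hw0 : ∀ k s' U V', 0 ≤ wOfRecord₉ F N ϑ p g k s' U V') (ρ t : ℝ)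
    (a : ↥(cubeIndices (F.P p.K) (cubeSide (F.P p.K).L ϑ.ν.M₂ (RkOfRecord (F.P p.K).L ϑ.ν.r (g k)) k))) (s : SeqOfRecord F ϑ.ν ϑ.τ9.M g p.K k) :
    0 ≤ shellPieceOfDatum₉ F N ϑ D g₀ os p g k ρ t a s := by
  by_cases h : a ∈ cubesOfSeq F ϑ.ν ϑ.τ9.M g p.K k s
  · rw [shellPieceOfDatum₉_of_mem F N ϑ D g₀ os p g k h]
    exact integral_nonneg fun V => pieceIntegrand_nonneg F N ϑ D g₀ os p g k hw0 _ t a s V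
  · rw [shellPieceOfDatum₉_of_not_mem F N ϑ D g₀ os p g k h]

/-- **THE TRUNCATED CLASS WEIGHT NEVER EXCEEDS THE CLASS WEIGHT** (and is nonnegative). [bookkeeping] -/
theorem cubeWeightOfDatum₉_le_classWeight (hw0 : ∀ k s' U V', 0 ≤ wOfRecord₉ F N ϑ p g k s' U V') (t : ℝ)
    (a : ↥(cubeIndices (F.P p.K) (cubeSide (F.P p.K).L ϑ.ν.M₂ (RkOfRecord (F.P p.K).L ϑ.ν.r (g k)) k))) (s : SeqOfRecord F ϑ.ν ϑ.τ9.M g p.K k) :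
    cubeWeightOfDatum₉ F N ϑ D g₀ os p g k t a s ≤ classWeightOfDatum₉ F N ϑ D g₀ os p g k t s := by
  by_cases h : a ∈ cubesOfSeq F ϑ.ν ϑ.τ9.M g p.K k s
  · rw [cubeWeightOfDatum₉_of_mem F N ϑ D g₀ os p g k h]
  · rw [cubeWeightOfDatum₉_of_not_mem F N ϑ D g₀ os p g k h]
    exact classWeightOfDatum₉_nonneg' F N ϑ D g₀ os p g k hw0 t s

/-- **THE TRUNCATED CLASS WEIGHT IS NONNEGATIVE.** [bookkeeping] -/
theorem cubeWeightOfDatum₉_nonneg (hw0 : ∀ k s' U V', 0 ≤ wOfRecord₉ F N ϑ p g k s' U V') (t : ℝ)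
    (a : ↥(cubeIndices (F.P p.K) (cubeSide (F.P p.K).L ϑ.ν.M₂ (RkOfRecord (F.P p.K).L ϑ.ν.r (g k)) k))) (s : SeqOfRecord F ϑ.ν ϑ.τ9.M g p.K k) :
    0 ≤ cubeWeightOfDatum₉ F N ϑ D g₀ os p g k t a s := by
  by_cases h : a ∈ cubesOfSeq F ϑ.ν ϑ.τ9.M g p.K k s
  · rw [cubeWeightOfDatum₉_of_mem F N ϑ D g₀ os p g k h]; exact classWeightOfDatum₉_nonneg' F N ϑ D g₀ os p g k hw0 t s
  · rw [cubeWeightOfDatum₉_of_not_mem F N ϑ D g₀ os p g k h]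

/-- integrability of a cube piece's integrand (bounded measurable factor × F3's integrable piece). [bookkeeping] -/
theorem integrable_pieceIntegrand (hU : LocalBgMeasurable F N ϑ.ν) (δ t : ℝ)
    (a : ↥(cubeIndices (F.P p.K) (cubeSide (F.P p.K).L ϑ.ν.M₂ (RkOfRecord (F.P p.K).L ϑ.ν.r (g k)) k))) (s : SeqOfRecord F ϑ.ν ϑ.τ9.M g p.K k)
    (hint : Integrable (fun V => chiSeqOfRecord F N ϑ.ν ϑ.τ9.M g p.K k s V * dressedSlotsOfDatum₉ F N ϑ D g₀ os t p g k s V)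
      (fieldMeasure (F.P p.K) k (SU N))) :
    Integrable (fun V => (1 - cubeChiAt F N ϑ.ν g p.K k δ a V) *
      (chiSeqOfRecord F N ϑ.ν ϑ.τ9.M g p.K k s V * dressedSlotsOfDatum₉ F N ϑ D g₀ os t p g k s V)) (fieldMeasure (F.P p.K) k (SU N)) := by
  refine hint.bdd_mul (c := 1) ((measurable_const.sub (measurable_cubeChiAt F N ϑ.ν g p.K k hU δ a)).aestronglyMeasurable)
    (ae_of_all _ fun V => ?_)
  have h0 := cubeChiAt_nonneg F N ϑ.ν g p.K k δ a V
  have h1 := cubeChiAt_le_one F N ϑ.ν g p.K k δ a V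
  rw [Real.norm_eq_abs, abs_le]
  constructor <;> linarith

/-- ★ **THE COVER**: the term's shell part is at most the sum of its top-cube pieces — `σ(s) ≤ Σ_a piece_a(s)` (pieces vanish off `Ω_k(s)`; §2's pointwise cover
integrated; displayed: (H-U) for the measurability of the cube indicators, F3's (e1) integrability). [bookkeeping] -/
theorem shellWeightOfDatum₉_le_sum_pieces (hU : LocalBgMeasurable F N ϑ.ν) (hw0 : ∀ k s' U V', 0 ≤ wOfRecord₉ F N ϑ p g k s' U V') (ρ t : ℝ)
    (s : SeqOfRecord F ϑ.ν ϑ.τ9.M g p.K k)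
    (hint : Integrable (fun V => chiSeqOfRecord F N ϑ.ν ϑ.τ9.M g p.K k s V * dressedSlotsOfDatum₉ F N ϑ D g₀ os t p g k s V)
      (fieldMeasure (F.P p.K) k (SU N))) :
    shellWeightOfDatum₉ F N ϑ D g₀ os p g k ρ t s ≤ ∑ a, shellPieceOfDatum₉ F N ϑ D g₀ os p g k ρ t a s := by
  -- pieces vanish off `Ω_k(s)`: the full sum is the sum over the cubes of `s`
  have hvanish : ∑ a, shellPieceOfDatum₉ F N ϑ D g₀ os p g k ρ t a s =
      ∑ a ∈ cubesOfSeq F ϑ.ν ϑ.τ9.M g p.K k s, shellPieceOfDatum₉ F N ϑ D g₀ os p g k ρ t a s := by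
    refine (Finset.sum_subset (Finset.subset_univ _) fun a _ ha => ?_).symm
    exact shellPieceOfDatum₉_of_not_mem F N ϑ D g₀ os p g k ha
  rw [hvanish]
  have hpieces : ∑ a ∈ cubesOfSeq F ϑ.ν ϑ.τ9.M g p.K k s, shellPieceOfDatum₉ F N ϑ D g₀ os p g k ρ t a s =
      ∑ a ∈ cubesOfSeq F ϑ.ν ϑ.τ9.M g p.K k s, ∫ V, (1 - cubeChiAt F N ϑ.ν g p.K k (epsOfRecord ϑ.ν g k * (1 - ρ)) a V) *
        (chiSeqOfRecord F N ϑ.ν ϑ.τ9.M g p.K k s V * dressedSlotsOfDatum₉ F N ϑ D g₀ os t p g k s V) ∂fieldMeasure (F.P p.K) k (SU N) :=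
    Finset.sum_congr rfl fun a ha => shellPieceOfDatum₉_of_mem F N ϑ D g₀ os p g k ha
  rw [hpieces, ← integral_finsetSum _ fun a _ => integrable_pieceIntegrand F N ϑ D g₀ os p g k hU _ t a s hint]
  refine integral_mono_of_nonneg (ae_of_all _ fun V => shellIntegrand_nonneg F N ϑ D g₀ os p g k hw0 _ t s V)
    (integrable_finsetSum _ fun a _ => integrable_pieceIntegrand F N ϑ D g₀ os p g k hU _ t a s hint)
    (ae_of_all _ fun V => ?_)
  exact shellIntegrand_le_sum_pieceIntegrand F N ϑ D g₀ os p g k hw0 _ t s V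

/-- ★★ **PER-TOP-CUBE (M1) ⇒ THE RUN's TOTAL SHELL PART.**  If for every top cube `a` the pieces weigh at most `c ×` the `a`-truncated class weights (the displayed
(M1) on the record's `a`-truncated dressed law, `0 ≤ c`), then `Σ_s σ(s) ≤ (#top cubes · c) · Σ_s classWeight(s)` — `T4ShellMeasure.shell_sum_le_of_slots` BY NAME with
the cover of this file. [bookkeeping] -/
theorem sum_shellWeight_le_of_cubeAC (hU : LocalBgMeasurable F N ϑ.ν) (hw0 : ∀ k s' U V', 0 ≤ wOfRecord₉ F N ϑ p g k s' U V') (ρ t : ℝ)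
    (hint : ∀ s : SeqOfRecord F ϑ.ν ϑ.τ9.M g p.K k,
      Integrable (fun V => chiSeqOfRecord F N ϑ.ν ϑ.τ9.M g p.K k s V * dressedSlotsOfDatum₉ F N ϑ D g₀ os t p g k s V) (fieldMeasure (F.P p.K) k (SU N)))
    {c : ℝ} (hc : 0 ≤ c)
    (hM1 : ∀ a : ↥(cubeIndices (F.P p.K) (cubeSide (F.P p.K).L ϑ.ν.M₂ (RkOfRecord (F.P p.K).L ϑ.ν.r (g k)) k)),
      ∑ s, shellPieceOfDatum₉ F N ϑ D g₀ os p g k ρ t a s ≤ c * ∑ s, cubeWeightOfDatum₉ F N ϑ D g₀ os p g k t a s) :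
    ∑ s, shellWeightOfDatum₉ F N ϑ D g₀ os p g k ρ t s ≤
      (((cubeIndices (F.P p.K) (cubeSide (F.P p.K).L ϑ.ν.M₂ (RkOfRecord (F.P p.K).L ϑ.ν.r (g k)) k)).card : ℝ) * c) *
        ∑ s, classWeightOfDatum₉ F N ϑ D g₀ os p g k t s := by
  have h := T4ShellMeasure.shell_sum_le_of_slots (Finset.univ : Finset (SeqOfRecord F ϑ.ν ϑ.τ9.M g p.K k))
    (Finset.univ : Finset ↥(cubeIndices (F.P p.K) (cubeSide (F.P p.K).L ϑ.ν.M₂ (RkOfRecord (F.P p.K).L ϑ.ν.r (g k)) k)))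
    (fun s => shellWeightOfDatum₉ F N ϑ D g₀ os p g k ρ t s) (fun s => classWeightOfDatum₉ F N ϑ D g₀ os p g k t s)
    (fun a s => shellPieceOfDatum₉ F N ϑ D g₀ os p g k ρ t a s) (fun _ => c)
    (fun s _ => shellWeightOfDatum₉_le_sum_pieces F N ϑ D g₀ os p g k hU hw0 ρ t s (hint s))
    (fun a _ => (hM1 a).trans (mul_le_mul_of_nonneg_left
      (Finset.sum_le_sum fun s _ => cubeWeightOfDatum₉_le_classWeight F N ϑ D g₀ os p g k hw0 t a s) hc))
  rw [Finset.sum_const, nsmul_eq_mul, Finset.card_univ, Fintype.card_coe] at h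
  exact h

/-! ### §3b The CORE of record: class weight minus shell part = the term re-tested at the LOWERED threshold (N19′'s object made definite) -/

/-- a product of `{0,1}`-valued factors is `{0,1}`-valued: def-T's front factor at any letter takes the values `0, 1` only. [bookkeeping] -/
theorem chiSeqOfRecordAt_eq_zero_or_one (δ : ℝ) (s : SeqOfRecord F ϑ.ν ϑ.τ9.M g p.K k) (V : GaugeField (F.P p.K) k (SU N)) :
    chiSeqOfRecordAt F N ϑ.ν ϑ.τ9.M g p.K k δ s V = 0 ∨ chiSeqOfRecordAt F N ϑ.ν ϑ.τ9.M g p.K k δ s V = 1 := by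
  rw [chiSeqOfRecordAt_eq_prod_cubeChiAt]
  refine Finset.prod_induction _ (fun x : ℝ => x = 0 ∨ x = 1) ?_ (Or.inr rfl) fun a _ => cubeChiAt_eq_zero_or_one F N ϑ.ν g p.K k δ a V
  rintro x y (rfl | rfl) (rfl | rfl) <;> simp

/-- **AT A LOWERED LETTER THE TWO FRONT FACTORS MULTIPLY TO THE LOWERED ONE**: `δ ≤ ε_k ⇒ χ_k^{ε_k}(s)·χ_k^{δ}(s) = χ_k^{δ}(s)` pointwise (`{0,1}`-valued, monotone in the
letter — def-T's `chiSeqOfRecordAt_mono`). [bookkeeping] -/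
theorem chiSeqOfRecord_mul_chiSeqOfRecordAt_of_le {δ : ℝ} (hδ : δ ≤ epsOfRecord ϑ.ν g k) (s : SeqOfRecord F ϑ.ν ϑ.τ9.M g p.K k)
    (V : GaugeField (F.P p.K) k (SU N)) :
    chiSeqOfRecord F N ϑ.ν ϑ.τ9.M g p.K k s V * chiSeqOfRecordAt F N ϑ.ν ϑ.τ9.M g p.K k δ s V = chiSeqOfRecordAt F N ϑ.ν ϑ.τ9.M g p.K k δ s V := by
  have hmono : chiSeqOfRecordAt F N ϑ.ν ϑ.τ9.M g p.K k δ s V ≤ chiSeqOfRecord F N ϑ.ν ϑ.τ9.M g p.K k s V := by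
    rw [chiSeqOfRecord_eq_at]
    exact chiSeqOfRecordAt_mono F N ϑ.ν ϑ.τ9.M g p.K k hδ s V
  have h0 := chiSeqOfRecordAt_nonneg F N ϑ.ν ϑ.τ9.M g p.K k δ s V
  rcases chiSeqOfRecordAt_eq_zero_or_one F N ϑ p g k (epsOfRecord ϑ.ν g k) s V with h | h
  · rw [chiSeqOfRecord_eq_at, h] at hmono
    rw [chiSeqOfRecord_eq_at, h, zero_mul]
    linarith
  · rw [chiSeqOfRecord_eq_at, h, one_mul]

/-- integrability of the shell integrand (bounded measurable factor × F3's integrable piece; (H-U) for def-T's front factor at the lowered letter). [bookkeeping] -/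
theorem integrable_shellIntegrand (hU : LocalBgMeasurable F N ϑ.ν) (δ t : ℝ) (s : SeqOfRecord F ϑ.ν ϑ.τ9.M g p.K k)
    (hint : Integrable (fun V => chiSeqOfRecord F N ϑ.ν ϑ.τ9.M g p.K k s V * dressedSlotsOfDatum₉ F N ϑ D g₀ os t p g k s V)
      (fieldMeasure (F.P p.K) k (SU N))) :
    Integrable (fun V => chiSeqOfRecord F N ϑ.ν ϑ.τ9.M g p.K k s V * (1 - chiSeqOfRecordAt F N ϑ.ν ϑ.τ9.M g p.K k δ s V) *
      dressedSlotsOfDatum₉ F N ϑ D g₀ os t p g k s V) (fieldMeasure (F.P p.K) k (SU N)) := by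
  have h := hint.bdd_mul (c := 1)
    (((measurable_chiSeqOfRecordAt_of_localBg hU ϑ.τ9.M g p.K k δ s).const_sub (1 : ℝ)).aestronglyMeasurable)
    (ae_of_all _ fun V => by
      have h0 := chiSeqOfRecordAt_nonneg F N ϑ.ν ϑ.τ9.M g p.K k δ s V
      have h1 := chiSeqOfRecordAt_le_one F N ϑ.ν ϑ.τ9.M g p.K k δ s V
      rw [Real.norm_eq_abs, abs_le]
      constructor <;> linarith)
  refine h.congr (ae_of_all _ fun V => ?_)
  simp only
  ring

/-- ★ **THE CORE OF RECORD**: class weight minus shell part `= ∫ χ_k^{ε_k}(s)·χ_k^{ε_k(1−ρ)}(s)·slot_s` (F3's (e1) integrability and (H-U) displayed). [bookkeeping] -/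
theorem classWeight_sub_shellWeight_eq (hU : LocalBgMeasurable F N ϑ.ν) (ρ t : ℝ) (s : SeqOfRecord F ϑ.ν ϑ.τ9.M g p.K k)
    (hint : Integrable (fun V => chiSeqOfRecord F N ϑ.ν ϑ.τ9.M g p.K k s V * dressedSlotsOfDatum₉ F N ϑ D g₀ os t p g k s V)
      (fieldMeasure (F.P p.K) k (SU N))) :
    classWeightOfDatum₉ F N ϑ D g₀ os p g k t s - shellWeightOfDatum₉ F N ϑ D g₀ os p g k ρ t s =
      ∫ V, chiSeqOfRecord F N ϑ.ν ϑ.τ9.M g p.K k s V * chiSeqOfRecordAt F N ϑ.ν ϑ.τ9.M g p.K k (epsOfRecord ϑ.ν g k * (1 - ρ)) s V *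
        dressedSlotsOfDatum₉ F N ϑ D g₀ os t p g k s V ∂fieldMeasure (F.P p.K) k (SU N) := by
  unfold classWeightOfDatum₉ shellWeightOfDatum₉
  rw [← integral_sub hint (integrable_shellIntegrand F N ϑ D g₀ os p g k hU _ t s hint)]
  refine integral_congr_ae (ae_of_all _ fun V => ?_)
  simp only
  ring

/-- ★★ **THE CORE OF RECORD IS THE TERM RE-TESTED AT THE LOWERED THRESHOLD**: for `0 ≤ ε_k·ρ` (the lowered letter `ε_k(1 − ρ)` does not exceed `ε_k`),
`classWeight − shellWeight = ∫ χ_k^{ε_k(1−ρ)}(Ω_k(s))·slot_s` — the (2.18) class weight of `s` with the (2.17) test at the LOWERED threshold: design (i)'s core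
(`T4IndicatorShell` §3's one-integral monotone device compares THESE across the two runs under N16's closeness) is now a DEFINITE object of record for N19′.
[bookkeeping] -/
theorem classWeight_sub_shellWeight_eq_lowered (hU : LocalBgMeasurable F N ϑ.ν) {ρ : ℝ} (hρ : 0 ≤ epsOfRecord ϑ.ν g k * ρ) (t : ℝ)
    (s : SeqOfRecord F ϑ.ν ϑ.τ9.M g p.K k)
    (hint : Integrable (fun V => chiSeqOfRecord F N ϑ.ν ϑ.τ9.M g p.K k s V * dressedSlotsOfDatum₉ F N ϑ D g₀ os t p g k s V)
      (fieldMeasure (F.P p.K) k (SU N))) :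
    classWeightOfDatum₉ F N ϑ D g₀ os p g k t s - shellWeightOfDatum₉ F N ϑ D g₀ os p g k ρ t s =
      ∫ V, chiSeqOfRecordAt F N ϑ.ν ϑ.τ9.M g p.K k (epsOfRecord ϑ.ν g k * (1 - ρ)) s V *
        dressedSlotsOfDatum₉ F N ϑ D g₀ os t p g k s V ∂fieldMeasure (F.P p.K) k (SU N) := by
  rw [classWeight_sub_shellWeight_eq F N ϑ D g₀ os p g k hU ρ t s hint]
  refine integral_congr_ae (ae_of_all _ fun V => ?_)
  have hle : epsOfRecord ϑ.ν g k * (1 - ρ) ≤ epsOfRecord ϑ.ν g k := by nlinarith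
  simp only
  rw [chiSeqOfRecord_mul_chiSeqOfRecordAt_of_le F N ϑ p g k hle s V]

end Term

/-! ## §4 The count: at the top level the cube partition of record has at most `(2L^m)⁴` cubes, uniformly in the cutoff -/

/-- **THE COUNT** (torus geometry, COUNTED): at the top level `k = Kc` of the cutoff-`Kc` torus (`2L^{m+Kc}` fine sites per direction), the partition into cubes of side
`L^{Kc+1}·M₂·R` fine sites has at most `(2L^m)⁴` cubes (none if `M₂R = 0`) — the END's `LiveWindow.count` letter `ν̄`, `K`-uniform. [bookkeeping] -/
theorem card_cubeIndices_top_le (F : T4Family) (Kc M₂ R : ℕ) :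
    ((cubeIndices (F.P Kc) (cubeSide (F.P Kc).L M₂ R Kc)).card : ℝ) ≤ (2 * (F.L : ℝ) ^ F.m) ^ 4 := by
  -- the side count per direction
  set s := cubeSide (F.P Kc).L M₂ R Kc with hs
  set q := ((F.P Kc).sitesPerDir 0 + s - 1) / s with hq
  have hL : 1 < F.L := F.hL.2
  have hm : 1 ≤ F.m := F.hm
  have hPL : (F.P Kc).L = F.L := rfl
  have hPm : (F.P Kc).m = F.m := rfl
  have hPK : (F.P Kc).K = Kc := rfl
  have hPd : (F.P Kc).d = 4 := rfl
  have hsites : (F.P Kc).sitesPerDir 0 = 2 * F.L ^ (F.m + Kc) := by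
    simp [Params.sitesPerDir]
  -- `q ≤ 2 L^m`
  have hqle : q ≤ 2 * F.L ^ F.m := by
    rcases Nat.eq_zero_or_pos s with hs0 | hspos
    · rw [hq, hs0]; simp
    · -- `s ≥ L^{Kc+1}` since `M₂ R ≥ 1`
      have hMR : 1 ≤ M₂ * R := by
        rcases Nat.eq_zero_or_pos (M₂ * R) with h0 | h0
        · exfalso; rw [hs, cubeSide, mul_assoc, h0, mul_zero] at hspos; exact lt_irrefl _ hspos
        · exact h0
      have hsge : F.L ^ (Kc + 1) ≤ s := by
        rw [hs, cubeSide, hPL, mul_assoc]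
        exact Nat.le_mul_of_pos_right _ hMR
      obtain ⟨m', hm'⟩ : ∃ m', F.m = m' + 1 := ⟨F.m - 1, by omega⟩
      have hpowpos : 0 < F.L ^ (Kc + 1) := pow_pos (by omega) _
      calc q = ((F.P Kc).sitesPerDir 0 + s - 1) / s := hq
        _ ≤ ((F.P Kc).sitesPerDir 0 + s) / s := Nat.div_le_div_right (Nat.sub_le _ _)
        _ = (F.P Kc).sitesPerDir 0 / s + 1 := Nat.add_div_right _ hspos
        _ ≤ (F.P Kc).sitesPerDir 0 / F.L ^ (Kc + 1) + 1 := Nat.add_le_add_right (Nat.div_le_div_left hsge hpowpos) 1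
        _ = 2 * F.L ^ m' + 1 := by
            rw [hsites, hm', show m' + 1 + Kc = m' + (Kc + 1) by omega, pow_add, ← mul_assoc, Nat.mul_div_cancel _ hpowpos]
        _ ≤ 2 * F.L ^ F.m := by
            rw [hm', pow_succ]
            have h1 : 1 ≤ F.L ^ m' := Nat.one_le_pow _ _ (by omega)
            nlinarith
  -- the card of the index family is `q^4`
  have hcard : (cubeIndices (F.P Kc) s).card = q ^ 4 := by
    rw [cubeIndices, Fintype.card_piFinset, Finset.prod_const, Finset.card_univ, Fintype.card_fin, hPd,
      Finset.card_image_of_injective _ Nat.cast_injective, Finset.card_range]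
  rw [hcard]
  have : (q : ℝ) ^ 4 ≤ (2 * (F.L : ℝ) ^ F.m) ^ 4 := by
    gcongr
    exact_mod_cast hqle
  exact_mod_cast this

end Summit.QuantumFields.YangMills.Theorems.N21ShellSplitOfRecord13CoPH

end
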